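import Mathlib
import HarnessLib
import Literature.Computability.AlgebraicComplexity.BLMW11WeakValiantHypothesis
import Summits.ValiantsHypothesis.ValiantsHypothesis.Theorems.DefinabilityGapAffineRung
import Summits.ValiantsHypothesis.ValiantsHypothesis.Theorems.DefinabilityGapKIReconstructionWs

/-!
# DefinabilityGap — Valiant's WEAK hypothesis ⟹ K1ws, kernel modulo `VBP` factor closure
# (support for `KIPlantedHitting`, item `stmt-ValiantsHypothesis-23547`)

Support for route `route-ValiantsHypothesis-DefinabilityGap` (decomp-valiant lens 5, gen 2). The split child K1ws
(`KIPlantedHittingWs`: the KI-planted permanent map `G_m = kiPer m` is an i.o. hitting-set generator against adversaries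
of WEAKLY-SKEW size `q(m)^b`) sits BELOW Valiant's weak hypothesis `DcPerSuperpolynomial ℂ` (`= (per_m) ∉ VP_ws`,
BLMW 2011 §9.2) modulo one literature input, factor closure of `VBP` in `L_ws` currency (Sinhababu–Thierauf 2021, Thm 1),
carried as the explicit hypothesis `hfac`:

* `kiPlantedHittingWs_of_factorClosure_of_dcPer : hfac → DcPerSuperpolynomial ℂ → K1ws` (K1ws spelled out over the
  `DefinabilityGapAffineRung` copies of `qOf`/`kiPer`, delta-equal to the route's).

Proof: `L_ws(per_m)` not p-bounded (`dcPerSuperpolynomial_iff_not_isVPwsFamily_perPoly`) ⟹ it exceeds the p-bounded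
threshold `(q^b + q)^A` at arbitrarily large `m` (`exists_large_of_not_isPBounded`) ⟹ by KI reconstruction in `VBP` currency
(`kiReconstructionWs_of_factorClosure`) no nonzero `D` with `L_ws(D) ≤ q^b` annihilates `G_m`.
-/

noncomputable section

open MvPolynomial
open Literature.Computability.AlgebraicComplexity Literature.Computability.MetaComplexity
open Summit.ValiantsHypothesis.ValiantsHypothesis.Theorems.DefinabilityGapAffineRung (qOf qOf_spec sq_le_qOf kiPer)
open Summit.ValiantsHypothesis.ValiantsHypothesis.Theorems.DefinabilityGapKIReconstructionWs
  (kiReconstructionWs_of_factorClosure)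

namespace Summit.ValiantsHypothesis.ValiantsHypothesis.Theorems.DefinabilityGapWeakToK1ws

/-- `q(m)` is p-bounded (`q(m) ≤ 2(m²+1)`, Bertrand via `leastPrimeGe_le`). [folklore] -/
theorem isPBounded_qOf : IsPBounded qOf := by
  refine IsPBounded.mono (t := fun m => 2 * (m * m + 1)) ?_ (fun m => leastPrimeGe_le _ (by omega))
  exact IsPBounded.mul_holds (IsPBounded.const 2)
    (IsPBounded.add_holds (IsPBounded.mul_holds IsPBounded.id IsPBounded.id) (IsPBounded.const 1))

/-- A non-p-bounded function exceeds every `m^c + c` at arbitrarily LARGE arguments (finite-maximum argument).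
[folklore] -/
theorem exists_large_of_not_isPBounded {t : ℕ → ℕ} (ht : ¬ IsPBounded t) (c m₀ : ℕ) :
    ∃ m, m₀ ≤ m ∧ m ^ c + c < t m := by
  by_contra h
  push Not at h
  apply ht
  rw [IsPBounded.iff_exists_le_mul_succ_pow]
  refine ⟨c + 1 + ∑ i ∈ Finset.range m₀, t i, c, fun m => ?_⟩
  set S := ∑ i ∈ Finset.range m₀, t i with hS
  set P := (m + 1) ^ c with hP
  have hpow : 1 ≤ P := Nat.one_le_pow _ _ (Nat.succ_pos m)
  have hexp : (c + 1 + S) * P = P + c * P + S * P := by ring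
  by_cases hm : m₀ ≤ m
  · have h1 : t m ≤ m ^ c + c := h m hm
    have h2 : m ^ c ≤ P := Nat.pow_le_pow_left (Nat.le_succ m) c
    have h3 : c ≤ c * P := Nat.le_mul_of_pos_right c hpow
    have h5 : 0 ≤ S * P := Nat.zero_le _
    omega
  · have h4 : t m ≤ S :=
      Finset.single_le_sum (f := t) (fun i _ => Nat.zero_le _) (Finset.mem_range.2 (by omega))
    have h6 : S ≤ S * P := Nat.le_mul_of_pos_right S hpow
    omega

/-- **Valiant's weak hypothesis ⟹ K1ws, kernel modulo `VBP` factor closure.** With factor closure of `VBP` in `L_ws`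
currency as hypothesis (Sinhababu–Thierauf 2021, Thm 1), `(per_m) ∉ VP_ws` implies: for every `b` and cofinally many `m`,
every nonzero `D` of weakly-skew size `≤ q(m)^b` fails to annihilate `G_m` — literally the split child
`KIPlantedHittingWs` of the route. [cite: KabanetsImpagliazzo2003, Lemma 30; SinhababuThierauf2021, Thm 1;
BurgisserEtAl2011, §9.2] -/
theorem kiPlantedHittingWs_of_factorClosure_of_dcPer
    (hfac : ∃ a : ℕ, ∀ (σ : Type) [Fintype σ] [DecidableEq σ] (P Q : MvPolynomial σ ℂ), P ≠ 0 → Q ∣ P →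
      wsComplexity Q ≤ (wsComplexity P + Fintype.card σ + 2) ^ a)
    (hW : DcPerSuperpolynomial ℂ) :
    ∀ b m₀ : ℕ, ∃ m, m₀ ≤ m ∧
      ∀ D : MvPolynomial (Fin 3 → Fin (qOf m)) ℂ, D ≠ 0 → wsComplexity D ≤ qOf m ^ b → bind₁ (kiPer m) D ≠ 0 := by
  intro b m₀
  obtain ⟨a, ha⟩ := kiReconstructionWs_of_factorClosure hfac
  have hnp : ¬ IsPBounded (fun n => wsComplexity (perPoly (Fin n) ℂ)) :=
    dcPerSuperpolynomial_iff_not_isVPwsFamily_perPoly.1 hW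
  obtain ⟨c, hc⟩ : IsPBounded fun m => (qOf m ^ b + qOf m) ^ a :=
    IsPBounded.pow_holds (IsPBounded.add_holds (IsPBounded.pow_holds isPBounded_qOf b) isPBounded_qOf) a
  obtain ⟨m, hm, hlt⟩ := exists_large_of_not_isPBounded hnp c m₀
  refine ⟨m, hm, fun D hD hws hann => ?_⟩
  have h1 := ha m D hD hann
  have h2 : (wsComplexity D + qOf m) ^ a ≤ (qOf m ^ b + qOf m) ^ a := Nat.pow_le_pow_left (by omega) a
  have h3 := hc m
  dsimp only at h3 hlt
  omega

/-- Contrapositive reading (the PIT-axis dichotomy at `VP_ws`, kernel modulo factor closure): if K1ws FAILS — some `b`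
and cofinitely many `m` admit a nonzero weakly-skew-small annihilator of `G_m` — then `(per_m) ∈ VP_ws`, i.e. Valiant's
weak hypothesis fails. [cite: KabanetsImpagliazzo2003, Lemma 30; SinhababuThierauf2021, Thm 1] -/
theorem not_dcPer_of_factorClosure_of_not_kiPlantedHittingWs
    (hfac : ∃ a : ℕ, ∀ (σ : Type) [Fintype σ] [DecidableEq σ] (P Q : MvPolynomial σ ℂ), P ≠ 0 → Q ∣ P →
      wsComplexity Q ≤ (wsComplexity P + Fintype.card σ + 2) ^ a)
    (hK : ¬ ∀ b m₀ : ℕ, ∃ m, m₀ ≤ m ∧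
      ∀ D : MvPolynomial (Fin 3 → Fin (qOf m)) ℂ, D ≠ 0 → wsComplexity D ≤ qOf m ^ b → bind₁ (kiPer m) D ≠ 0) :
    ¬ DcPerSuperpolynomial ℂ :=
  fun hW => hK (kiPlantedHittingWs_of_factorClosure_of_dcPer hfac hW)

end Summit.ValiantsHypothesis.ValiantsHypothesis.Theorems.DefinabilityGapWeakToK1ws

end
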